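import Mathlib
import HarnessLib
import Summits.Langlands.Langlands.Statement
import Summits.Langlands.Langlands.Theorems.SmithKummerSeedCyclicPrimeDescentPrimeTwistMatching
import Literature.NumberTheory.GaloisRepresentations.TwistStableRestrictionReducible
import Literature.NumberTheory.GaloisRepresentations.LAdicRepFrobenius
import Literature.NumberTheory.GaloisRepresentations.FramedRepEquivConj
import Literature.NumberTheory.GaloisRepresentations.FrobeniusPlaces
import Literature.NumberTheory.GaloisRepresentations.AbsGaloisOuterConj
import Literature.NumberTheory.GaloisRepresentations.FramedRepTwist
import Literature.NumberTheory.GaloisRepresentations.FramedGaloisRepInduce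
import Literature.NumberTheory.Automorphic.ChebotarevArtinRepHolds
import Literature.RepresentationTheory.Semisimple.Twist

/-!
# A non-self-twist INERT place for `ρ₀` with `ρ₀|_{Γ_L}` irreducible
# (crux `AscentConjugationSolvable`, stmt-Langlands-1094; piece `CyclicPrimeAscent`; lead c3 helper stub H3)

Support file (closes nothing).  Let `L/K` be a Galois extension of number fields of PRIME degree
`p = [L:K]`, `π` an automorphic representation of `GL_n(𝔸_K)` and `ρ₀ : Γ_K → GL_n(ℚ̄_ℓ)` a
framed Galois representation which is Satake–Frobenius compatible with `(π, ι)` at all but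
finitely many places (`SatakeFrobCompatibleAt`), and whose restriction `ρ₀|_{Γ_L}` is
IRREDUCIBLE.  Then some finite place `v` of `K` INERT in `L` (a place `w ∣ v` of `L` of residue
degree `p`) carries a Satake parameter `α` of `π` which is NOT fixed by multiplication by any
primitive `p`-th root of unity — the hypothesis of cuspidal cyclic base change
(`Literature.NumberTheory.Automorphic.baseChange_cyclic_cuspidal`).

Proof (Arthur–Clozel, Ann. of Math. Stud. 120, Ch. 3, proof of Thm. 3.1 (p. 172) and
Thm. 4.2 (a); Galois side).  Suppose not: at every inert `v` every Satake parameter of `π` is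
`μ_p`-stable.  Let `η : Γ_K → ℚ̄_ℓˣ` be a continuous character with kernel EXACTLY `res(Γ_L)`
(`absGaloisQuot : Γ_K ↠ Gal(L/K)`, cyclic of prime order `p`, embedded in `μ_p(ℚ̄_ℓ)`), so that
`η(σ)` is a primitive `p`-th root of unity for `σ ∉ res(Γ_L)`.  At all but finitely many `v`
(`v` good for compatibility, unramified in `L`, with inertia groups inside `res(Γ_L)`:
`eventually_forall_inertia_le_range_absGaloisRestrict`) the representations `ρ₀` and `ρ₀ ⊗ η`
are unramified with the SAME characteristic polynomial of every arithmetic Frobenius `σ` above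
`v`: if `σ ∈ res(Γ_L)` then `η(σ) = 1`; if not, the place of `L` below the corresponding prime is
inert (`exists_place_inert_of_not_mem_range`), so the Satake parameter `α` at `v` is `μ_p`-stable,
and `charpoly(η(σ) ρ₀(σ))` has roots `η(σ) ι⁻¹(a⁻¹) = ι⁻¹((c a)⁻¹)`, `a ∈ α`, with
`c = ι(η(σ))⁻¹ ∈ μ_p(ℂ)` primitive, i.e. it is the polynomial predicted by `c · α = α`
(`arithFrobPolyOfSatake_one_map_const_mul`).  Chebotarev + Brauer–Nesbitt
(`FramedGaloisRep.nonempty_equiv_of_hasFrobCharpolyAt_eventually`, both sides semisimple since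
`ρ₀` is irreducible, `isIrreducible_of_isIrreducible_restrictField`) give `ρ₀ ≅ ρ₀ ⊗ η`, i.e.
`P ρ₀ P⁻¹ = ρ₀ ⊗ η` (`FramedRep.exists_eq_conj_of_equiv`), and then `ρ₀|_{Γ_L}` is reducible
(`FramedGaloisRep.not_isIrreducible_restrictField_of_conj_eq_twist`) — a contradiction.

References: J. Arthur, L. Clozel, *Simple algebras, base change, and the advanced theory of the
trace formula*, Ann. of Math. Stud. 120 (1989), Ch. 3, proof of Thm. 3.1 (p. 172), Thm. 4.2 (a);
P. Deligne, J.-P. Serre, Ann. Sci. ÉNS 7 (1974), Lemme 3.2; J. Neukirch, *Algebraic Number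
Theory* (1999), Ch. I §9.
-/

noncomputable section

set_option linter.dupNamespace false -- project-wide option; `Summit.Langlands.Langlands` is the mandated namespace

namespace Summit.Langlands.Langlands.Theorems.SmithKummerSeedCyclicPrimeAscent

open scoped MatrixGroups NumberField Classical Matrix Polynomial
open Filter IsDedekindDomain Field Polynomial
open Literature.NumberTheory.Automorphic Literature.NumberTheory.GaloisRepresentations
  Literature.NumberTheory.PAdicHodge
open Summit.Langlands

/-! ## `μ_p`-stability from one primitive root -/

/-- If a multiset `α ⊆ ℂ` is stable under multiplication by ONE primitive `p`-th root of unity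
`ζ`, it is stable under multiplication by every primitive `p`-th root of unity `c` (`c = ζ ^ i`;
iterate). [folklore] -/
private theorem multiset_map_mul_eq_of_isPrimitiveRoot {p : ℕ} [NeZero p] {α : Multiset ℂ}
    {ζ c : ℂ} (hζ : IsPrimitiveRoot ζ p) (hα : α.map (ζ * ·) = α) (hc : IsPrimitiveRoot c p) :
    α.map (c * ·) = α := by
  obtain ⟨i, -, rfl⟩ := hζ.eq_pow_of_pow_eq_one hc.pow_eq_one
  clear hc
  induction i with
  | zero => simp
  | succ i ih =>
    have h : (fun a : ℂ => ζ ^ (i + 1) * a) = (fun a : ℂ => ζ * a) ∘ (fun a : ℂ => ζ ^ i * a) := by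
      funext a
      simp only [Function.comp_apply, pow_succ]
      ring
    rw [h, ← Multiset.map_map, ih, hα]

/-! ## The order-`p` character `η` of `Γ_K` with kernel `res(Γ_L)` -/

section Character

variable {K L : Type} [Field K] [NumberField K] [Field L] [NumberField L] [Algebra K L]
  [IsGalois K L] {ℓ : ℕ} [Fact ℓ.Prime]

/-- **The character `η : Γ_K → ℚ̄_ℓˣ` of `Gal(L/K)` of exact order `p`.**  For `L/K` Galois of
prime degree `p`, there is a continuous character `η` of `Γ_K` with values in `ℚ̄_ℓˣ`, trivial on
`res(Γ_L)` and taking a PRIMITIVE `p`-th root of unity as value at every `σ ∉ res(Γ_L)`: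
`Γ_K ↠ Gal(L/K)` (`absGaloisQuot`, kernel `res(Γ_L)`), a cyclic group of prime order `p`,
composed with an isomorphism onto `μ_p(ℚ̄_ℓ)` (`mulEquivOfCyclicCardEq`); continuity from the
open kernel. [folklore] -/
private theorem exists_character (hp : (Module.finrank K L).Prime) :
    ∃ η : absoluteGaloisGroup K →ₜ* (PadicAlgCl ℓ)ˣ,
      (∀ τ : absoluteGaloisGroup K, τ ∈ (absGaloisRestrict K L).range → η τ = 1) ∧
      (∀ τ : absoluteGaloisGroup K, τ ∉ (absGaloisRestrict K L).range →
        IsPrimitiveRoot (η τ) (Module.finrank K L)) := by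
  haveI : FiniteDimensional K L := Module.finite_of_finrank_pos hp.pos
  haveI : Fact (Module.finrank K L).Prime := ⟨hp⟩
  haveI : NeZero (Module.finrank K L) := ⟨hp.ne_zero⟩
  haveI : NeZero ((Module.finrank K L : ℕ) : ℚ_[ℓ]) := ⟨Nat.cast_ne_zero.mpr hp.ne_zero⟩
  haveI : NeZero ((Module.finrank K L : ℕ) : PadicAlgCl ℓ) := ⟨Nat.cast_ne_zero.mpr hp.ne_zero⟩
  -- `Gal(L/K)` and `μ_p(ℚ̄_ℓ)` are cyclic of order `p`
  have hcardG : Nat.card (L ≃ₐ[K] L) = Module.finrank K L := IsGalois.card_aut_eq_finrank K L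
  have hcardμ : Nat.card (rootsOfUnity (Module.finrank K L) (PadicAlgCl ℓ)) = Module.finrank K L :=
    HasEnoughRootsOfUnity.natCard_rootsOfUnity (PadicAlgCl ℓ) (Module.finrank K L)
  haveI : IsCyclic (L ≃ₐ[K] L) := isCyclic_of_prime_card hcardG
  -- an injective homomorphism `Gal(L/K) → ℚ̄_ℓˣ`
  let e : (L ≃ₐ[K] L) ≃* rootsOfUnity (Module.finrank K L) (PadicAlgCl ℓ) :=
    mulEquivOfCyclicCardEq (hcardG.trans hcardμ.symm)
  let φ : (L ≃ₐ[K] L) →* (PadicAlgCl ℓ)ˣ :=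
    (rootsOfUnity (Module.finrank K L) (PadicAlgCl ℓ)).subtype.comp e.toMonoidHom
  have hφinj : Function.Injective φ :=
    (rootsOfUnity (Module.finrank K L) (PadicAlgCl ℓ)).subtype_injective.comp e.injective
  let η₀ : absoluteGaloisGroup K →* (PadicAlgCl ℓ)ˣ := φ.comp (absGaloisQuot K L)
  have hη₀ : ∀ τ, η₀ τ = φ (absGaloisQuot K L τ) := fun τ => rfl
  have hη₀1 : ∀ τ, τ ∈ (absGaloisRestrict K L).range → η₀ τ = 1 := fun τ hτ => by
    rw [hη₀, (absGaloisQuot_eq_one_iff K L τ).mpr hτ, map_one]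
  have hker : IsOpen (η₀.ker : Set (absoluteGaloisGroup K)) := by
    refine Subgroup.isOpen_mono (H₁ := (absGaloisRestrict K L).range) (fun τ hτ => ?_)
      (isOpen_range_absGaloisRestrict_and_index K L).1
    rw [MonoidHom.mem_ker]
    exact hη₀1 τ hτ
  refine ⟨⟨η₀, Literature.NumberTheory.Automorphic.MonoidHom.continuous_of_isOpen_ker η₀ hker⟩,
    hη₀1, fun τ hτ => ?_⟩
  -- `τ ∉ res(Γ_L)`: `τ̄ ≠ 1` has order `p`, and so does its image under the injective `φ`
  have hne : absGaloisQuot K L τ ≠ 1 := fun h => hτ ((absGaloisQuot_eq_one_iff K L τ).mp h)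
  have hpow : absGaloisQuot K L τ ^ Module.finrank K L = 1 := by
    rw [← hcardG]
    exact pow_card_eq_one'
  have hord : orderOf (absGaloisQuot K L τ) = Module.finrank K L := orderOf_eq_prime hpow hne
  show IsPrimitiveRoot (η₀ τ) (Module.finrank K L)
  have h := IsPrimitiveRoot.orderOf (η₀ τ)
  rw [hη₀] at h ⊢
  rw [orderOf_injective φ hφinj, hord] at h
  exact h

end Character

/-! ## `ρ₀` and `ρ₀ ⊗ η` have the same Frobenius polynomials almost everywhere -/

section Charpoly

variable {K L : Type} [Field K] [NumberField K] [Field L] [NumberField L] [Algebra K L]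
  [IsGalois K L] {n : ℕ} {hK : isCompact_glFiniteIntegralLevel n K} {ℓ : ℕ} [Fact ℓ.Prime]

omit [NumberField K] in
/-- **Twisted semisimplicity**: the twist of a semisimple framed Galois representation by a
continuous character is semisimple (same lattice of stable subspaces,
`Representation.isSemisimpleRepresentation_twist_iff`). [folklore] -/
private theorem isSemisimple_twist_padicAlgCl {ρ : FramedGaloisRep K (PadicAlgCl ℓ) n}
    (h : ρ.toGaloisRep.IsSemisimple) (χ : absoluteGaloisGroup K →ₜ* (PadicAlgCl ℓ)ˣ) :
    (FramedGaloisRep.toGaloisRep (FramedRep.twist ρ χ)).IsSemisimple := by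
  -- adapted from `HarrisLanTaylorThorneTwistedPairLimitProofs.isSemisimple_twist`
  have e : FramedRep.toRepresentation (FramedRep.twist ρ χ) =
      Literature.RepresentationTheory.Semisimple.Representation.twist
        (FramedRep.toRepresentation ρ) χ.toMonoidHom := by
    refine MonoidHom.ext fun g => LinearMap.ext fun v => ?_
    change ((FramedRep.twist ρ χ g : GL (Fin n) (PadicAlgCl ℓ)) :
        Matrix (Fin n) (Fin n) (PadicAlgCl ℓ)) *ᵥ v =
      ((χ.toMonoidHom g : (PadicAlgCl ℓ)ˣ) : PadicAlgCl ℓ) •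
        (((ρ g : GL (Fin n) (PadicAlgCl ℓ)) : Matrix (Fin n) (Fin n) (PadicAlgCl ℓ)) *ᵥ v)
    rw [FramedRep.coe_twist_apply, Matrix.smul_mulVec]
    rfl
  change (FramedRep.toRepresentation (FramedRep.twist ρ χ)).IsSemisimpleRepresentation
  rw [e]
  exact (Literature.RepresentationTheory.Semisimple.Representation.isSemisimpleRepresentation_twist_iff
    _ _).mpr h

/-- **Equal Frobenius polynomials of `ρ₀` and `ρ₀ ⊗ η` almost everywhere, if every inert Satake
parameter is `μ_p`-stable** (Arthur–Clozel Ch. 3, p. 172).  Let `η` be trivial on `res(Γ_L)`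
with primitive `p`-th roots of unity as values off `res(Γ_L)`, `π` a.e. compatible with `ρ₀`, and
suppose every Satake parameter of `π` at every place `v` with an inert `w ∣ v` is stable under
some primitive `p`-th root of unity.  Then at all but finitely many `v` both `ρ₀` and `ρ₀ ⊗ η` are
unramified with a common Frobenius characteristic polynomial: at a good `v` unramified in `L`
whose inertia groups lie in `res(Γ_L)`, a Frobenius `σ ∈ res(Γ_L)` has `η(σ) = 1`, and a
Frobenius `σ ∉ res(Γ_L)` sits over an inert place (`exists_place_inert_of_not_mem_range`), where
rescaling the roots `ι⁻¹(a⁻¹)` by the primitive root `η(σ)` is rescaling `α` by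
`ι(η(σ))⁻¹ ∈ μ_p(ℂ)`, which fixes `α`.
[cite: ArthurClozelAMS120, Ch. 3, proof of Thm. 3.1 (p. 172)] -/
private theorem eventually_common_charpoly_twist (hp : (Module.finrank K L).Prime)
    (ι : PadicAlgCl ℓ ≃+* ℂ) (π : AutomorphicRepData (AutomorphyDatum.gl n K hK))
    (ρ₀ : FramedGaloisRep K (PadicAlgCl ℓ) n) {η : absoluteGaloisGroup K →ₜ* (PadicAlgCl ℓ)ˣ}
    (hη1 : ∀ τ : absoluteGaloisGroup K, τ ∈ (absGaloisRestrict K L).range → η τ = 1)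
    (hηp : ∀ τ : absoluteGaloisGroup K, τ ∉ (absGaloisRestrict K L).range →
      IsPrimitiveRoot (η τ) (Module.finrank K L))
    (hcompat : ∀ᶠ v : HeightOneSpectrum (𝓞 K) in cofinite, SatakeFrobCompatibleAt ι π ρ₀ v)
    (hstab : ∀ (v : HeightOneSpectrum (𝓞 K)) (w : HeightOneSpectrum (𝓞 L)) (α : Multiset ℂ),
      w.asIdeal.under (𝓞 K) = v.asIdeal → w.asIdeal.inertiaDeg (𝓞 K) = Module.finrank K L →
      π.HasSatakeParamAt v α →
        ∃ ζ : ℂ, IsPrimitiveRoot ζ (Module.finrank K L) ∧ α.map (ζ * ·) = α) :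
    ∀ᶠ v : HeightOneSpectrum (𝓞 K) in cofinite,
      ρ₀.IsUnramifiedAt v ∧ FramedGaloisRep.IsUnramifiedAt v (FramedRep.twist ρ₀ η) ∧
        ∃ P : Polynomial (PadicAlgCl ℓ), ρ₀.HasFrobCharpolyAt v P ∧
          FramedGaloisRep.HasFrobCharpolyAt v P (FramedRep.twist ρ₀ η) := by
  haveI : FiniteDimensional K L := Module.finite_of_finrank_pos hp.pos
  haveI : NeZero (Module.finrank K L) := ⟨hp.ne_zero⟩
  have hunrL : ∀ᶠ v : HeightOneSpectrum (𝓞 K) in cofinite,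
      Algebra.IsUnramifiedIn (𝓞 L) v.asIdeal :=
    eventually_cofinite.mpr (finite_setOf_not_isUnramifiedIn K L)
  filter_upwards [hcompat, eventually_forall_inertia_le_range_absGaloisRestrict K L, hunrL]
    with v hv hI hunr
  obtain ⟨α, hα, hur, hcp⟩ := hv
  have hηI : ∀ 𝔓 ∈ v.primesAbove, ∀ σ ∈ 𝔓.inertia (absoluteGaloisGroup K), η σ = 1 :=
    fun 𝔓 h𝔓 σ hσ => hη1 σ (hI 𝔓 h𝔓 hσ)
  refine ⟨hur, FramedGaloisRep.isUnramifiedAt_twist hur hηI, _, hcp, fun 𝔓 h𝔓 σ hσ => ?_⟩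
  by_cases hmem : σ ∈ (absGaloisRestrict K L).range
  · -- `η σ = 1`: the twist does not change `ρ₀ σ`
    rw [← hcp 𝔓 h𝔓 σ hσ]
    unfold FramedRep.charpoly
    rw [FramedRep.twist_apply_of_eq_one _ _ (hη1 σ hmem)]
  · -- `σ ∉ res(Γ_L)`: the place of `L` below `ι 𝔓` is inert, so `α` is `μ_p`-stable
    obtain ⟨w, -, -, hwv, -, hf, -⟩ :=
      exists_place_inert_of_not_mem_range hp (normal_range_absGaloisRestrict K L)
        (isOpen_range_absGaloisRestrict_and_index K L).2 hunr h𝔓 (hI 𝔓 h𝔓) hσ hmem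
    obtain ⟨ζ, hζ, hζα⟩ := hstab v w α (congrArg HeightOneSpectrum.asIdeal hwv) hf hα
    -- `c = ι(η σ)⁻¹` is a primitive `p`-th root of unity in `ℂ`, so `c · α = α`
    have hc : IsPrimitiveRoot (ι ((η σ : (PadicAlgCl ℓ)ˣ) : PadicAlgCl ℓ))⁻¹ (Module.finrank K L) :=
      ((IsPrimitiveRoot.coe_units_iff.mpr (hηp σ hmem)).map_of_injective ι.injective).inv
    have hcα := multiset_map_mul_eq_of_isPrimitiveRoot hζ hζα hc
    -- the characteristic polynomial of `η(σ) • ρ₀(σ)`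
    have hcp' := hcp 𝔓 h𝔓 σ hσ
    rw [ReciprocityTRCM.arithFrobPolyOfSatake_one_eq_prod_map] at hcp'
    have key : FramedRep.charpoly (FramedRep.twist ρ₀ η) σ =
        ((α.map fun a => ι.symm a⁻¹).map fun b =>
          X - C (((η σ : (PadicAlgCl ℓ)ˣ) : PadicAlgCl ℓ) * b)).prod := by
      change Matrix.charpoly ((FramedRep.twist ρ₀ η σ : GL (Fin n) (PadicAlgCl ℓ)) :
        Matrix (Fin n) (Fin n) (PadicAlgCl ℓ)) = _
      rw [FramedRep.coe_twist_apply]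
      exact Matrix.charpoly_smul_of_eq_prod hcp' (η σ).ne_zero
    have hR := SmithKummerSeedCyclicPrimeDescent.arithFrobPolyOfSatake_one_map_const_mul ι
      v.residueCard α (ι ((η σ : (PadicAlgCl ℓ)ˣ) : PadicAlgCl ℓ))⁻¹
    rw [hcα, inv_inv, RingEquiv.symm_apply_apply] at hR
    rw [key, hR]

end Charpoly

/-! ## Registered sub-goal form (crux stmt-Langlands-1094, line `registered`, stub H3) -/

/-- HELPER STUB H3 — **a non-self-twist INERT place** (the hypothesis of `baseChange_cyclic_cuspidal`): for
`L/K` Galois of prime degree `p`, `π` a.e. Satake–Frobenius compatible with `ρ₀` and `ρ₀|_{Γ_L}` IRREDUCIBLE,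
some place `v` of `K` inert in `L` carries a Satake parameter of `π` not fixed by any primitive `p`-th root of
unity — else `ρ₀` and `ρ₀ ⊗ η` (`η` the order-`p` character of `Gal(L/K)`) have equal Frobenius polynomials a.e.,
so `ρ₀ ≅ ρ₀ ⊗ η` (Chebotarev + Brauer–Nesbitt), so `ρ₀|_{Γ_L}` is reducible
(`not_isIrreducible_restrictField_of_conj_eq_twist`). [cite: ArthurClozelAMS120, Ch. 3, proof of Thm. 3.1 and Thm. 4.2 (a)] -/
theorem exists_inert_nonSelfTwist_of_irreducible_restrictField : ∀ (K L : Type) [Field K] [NumberField K] [Field L] [NumberField L] [Algebra K L] [IsGalois K L], (Module.finrank K L).Prime → ∀ (n : ℕ) (hK : Literature.NumberTheory.Automorphic.isCompact_glFiniteIntegralLevel n K) (ℓ : ℕ) [Fact ℓ.Prime] (ι : PadicAlgCl ℓ ≃+* ℂ) (π : Literature.NumberTheory.Automorphic.AutomorphicRepData (Literature.NumberTheory.Automorphic.AutomorphyDatum.gl n K hK)) (ρ₀ : Literature.NumberTheory.GaloisRepresentations.FramedGaloisRep K (PadicAlgCl ℓ) n), (ρ₀.restrictField L).toGaloisRep.IsIrreducible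 → (∀ᶠ v : IsDedekindDomain.HeightOneSpectrum (NumberField.RingOfIntegers K) in Filter.cofinite, SatakeFrobCompatibleAt ι π ρ₀ v) → ∃ (v : IsDedekindDomain.HeightOneSpectrum (NumberField.RingOfIntegers K)) (w : IsDedekindDomain.HeightOneSpectrum (NumberField.RingOfIntegers L)) (α : Multiset ℂ), w.asIdeal.under (NumberField.RingOfIntegers K) = v.asIdeal ∧ w.asIdeal.inertiaDeg (NumberField.RingOfIntegers K) = Module.finrank K L ∧ π.HasSatakeParamAt v α ∧ ∀ ζ : ℂ, IsPrimitiveRoot ζ (Module.finrank K L) → α.map (ζ * ·) ≠ α := by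
  intro K L _ _ _ _ _ _ hp n hK ℓ _ ι π ρ₀ hirr hcompat
  by_contra hne
  push Not at hne
  haveI : FiniteDimensional K L := Module.finite_of_finrank_pos hp.pos
  -- the order-`p` character `η` of `Gal(L/K)`
  obtain ⟨η, hη1, hηp⟩ := exists_character (K := K) (L := L) (ℓ := ℓ) hp
  have hηL : ∀ σ : absoluteGaloisGroup L, η (absGaloisRestrict K L σ) = 1 :=
    fun σ => hη1 _ ⟨σ, rfl⟩
  have hη_ne : η ≠ 1 := by
    have hidx := (isOpen_range_absGaloisRestrict_and_index K L).2
    obtain ⟨τ, hτ⟩ : ∃ τ : absoluteGaloisGroup K, τ ∉ (absGaloisRestrict K L).range := by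
      by_contra h
      push Not at h
      have htop : (absGaloisRestrict K L).range = ⊤ := eq_top_iff.mpr fun τ _ => h τ
      rw [htop, Subgroup.index_top] at hidx
      exact hp.one_lt.ne hidx
    intro h
    have h1 : η τ = 1 := by rw [h, ContinuousMonoidHom.coe_one, Pi.one_apply]
    exact (hηp τ hτ).ne_one hp.one_lt h1
  -- `ρ₀` is irreducible, hence `ρ₀` and `ρ₀ ⊗ η` are semisimple
  have hirr₀ : ρ₀.toGaloisRep.IsIrreducible :=
    IrreducibleOffSector.isIrreducible_of_isIrreducible_restrictField (L := L) ρ₀ hirr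
  have hss : ρ₀.toGaloisRep.IsSemisimple := IrreducibleOffSector.isSemisimple_of_isIrreducible ρ₀ hirr₀
  have hss' : (FramedGaloisRep.toGaloisRep (FramedRep.twist ρ₀ η)).IsSemisimple :=
    isSemisimple_twist_padicAlgCl hss η
  -- Chebotarev + Brauer–Nesbitt: `ρ₀ ≅ ρ₀ ⊗ η`, hence `P ρ₀ P⁻¹ = ρ₀ ⊗ η`
  obtain ⟨e⟩ := FramedGaloisRep.nonempty_equiv_of_hasFrobCharpolyAt_eventually
    chebotarev_artinRep_holds ρ₀ (FramedRep.twist ρ₀ η) hss hss'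
    (eventually_common_charpoly_twist hp ι π ρ₀ hη1 hηp hcompat hne)
  obtain ⟨P, hP⟩ := FramedRep.exists_eq_conj_of_equiv ρ₀ (FramedRep.twist ρ₀ η) e
  -- so `ρ₀|_{Γ_L}` is reducible: contradiction
  exact FramedGaloisRep.not_isIrreducible_restrictField_of_conj_eq_twist ρ₀ η hηL hη_ne
    ⟨P, hP.symm⟩ ((FramedRep.isIrreducible_toContinuousRep_iff _).mp hirr)

end Summit.Langlands.Langlands.Theorems.SmithKummerSeedCyclicPrimeAscent

end
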